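import Summits.SmoothPoincare4.SmoothPoincare4.Theorems.EntropyRungCompactGapOfChangGurskyYangForms
import Summits.SmoothPoincare4.SmoothPoincare4.Theorems.EntropyRungCompactShrinkerGapVarianceBudgetOfCertificate
import Summits.SmoothPoincare4.SmoothPoincare4.Theorems.EntropyRungCompactShrinkerGapLevelSetCertificate
import Summits.SmoothPoincare4.SmoothPoincare4.Theorems.EntropyRungCompactShrinkerGapVarianceBudgetOfVolumeCertificate
import Summits.SmoothPoincare4.SmoothPoincare4.Theorems.EntropyRungCompactShrinkerGapVolumeCertificate
import Literature.Geometry.Riemannian.ChernGaussBonnetFourProofs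
import HarnessLib

/-!
# The three scalar doors of crux `EntropyRung.CompactShrinkerGap`, as importable reductions free of the
Chern–Gauss–Bonnet hypothesis (line `cgy-variance-pivot`, skeleton v15, tenth lead)

Crux stmt-SmoothPoincare4-10870: a closed `M ≃ₕ S⁴` carrying a normalised gradient shrinker `Ric + Hess f = g/2`,
`R + |∇f|² = f`, of Gaussian mass `∫ e^{-f} dV > 32π²√π e^{-3/2}` is diffeomorphic to `S⁴`.

The picked line reduces the crux to Chang–Gursky–Yang's Theorem A (`EntropyRung.ChangGurskyYang`, route crux
stmt-SmoothPoincare4-10834) plus ONE research-open statement, registered on the item in several strengths. Up to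
skeleton v14 every strength but the Weyl budget itself closed the crux only modulo the NAMED FACT
`Literature.Geometry.Riemannian.chernGaussBonnet_four` (the dictionary `∫|W|² = (D + 4V)/3 − 2(V − 32π²)` between
the Weyl energy and the scalar-curvature variance `D = ∫(R − 2)² dV` is Chern–Gauss–Bonnet at `χ = 2`). That fact
is now a THEOREM of the tree (`chernGaussBonnet_four_holds`, `ChernGaussBonnetFourProofs.lean`: Chern's intrinsic
proof), so the three scalar doors become reductions conditional on the route crux alone. This file records them
as the registered helpers

* `helper_varianceDoorReduction`  : `ChangGurskyYang → VarianceBudget → CompactShrinkerGap`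
  (`VarianceBudget` = the registered signature of `stub_varianceBudget`: `∫(R − 2)² dV < 2·Vol − 96π²`);
* `helper_levelSetDoorReduction`  : `ChangGurskyYang → ScalarLeSevenHalves → CompactShrinkerGap`
  (`R ≤ 7/2` everywhere; through the landed LP-dual level-set certificate p123399 + its integration p122222);
* `helper_volumeDoorReduction`    : `ChangGurskyYang → VolumeComparison → ScalarLeTen → CompactShrinkerGap`
  (`Vol ≤ 96π²` and `R ≤ 10`; through the landed volume certificate p125661 + its integration p124526),

next to the ninth lead's `helper_einsteinDoorReduction` (door E, `EinsteinDoorReduction.lean`) and the glue prover's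
`compactGapOfChangGurskyYang_of_weylBudget` (door A, `EntropyRungCompactGapOfChangGurskyYangReduction.lean`). Each
is what a planner-filed item with the corresponding text would be closed by (`exact helper_… hCGY hItem`), and each
makes glue item stmt-SmoothPoincare4-14743 (`ChangGurskyYang → CompactShrinkerGap`) a one-liner from that item.
No Theses statement is concluded here; the open content (the hypotheses) is untouched.

References: Chang–Gursky–Yang, Publ. Math. IHÉS 98 (2003), Thm. A and (1.1); Cheng–Ribeiro–Zhou, arXiv:2203.14916
(2022/23), §3.2; Besse, Einstein Manifolds (1987), 6.31.
-/

noncomputable section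

open MeasureTheory Set
open scoped Manifold ContDiff ENNReal Topology ContinuousMap

namespace Summit.SmoothPoincare4.SmoothPoincare4.Theorems

-- the registered namespace `Summit.SmoothPoincare4.SmoothPoincare4.Theorems` repeats a component (summit = sub-problem)
set_option linter.dupNamespace false

open Summit.SmoothPoincare4.SmoothPoincare4.Theses.EntropyRung (CompactShrinkerGap ChangGurskyYang)

/-- **Door A′ (variance budget), CGB-free.** If every dense normalised gradient shrinker on a closed homotopy
4-sphere satisfies the variance budget `∫(R − 2)² dV < 2·Vol − 96π²` (the hypothesis is VERBATIM the registered
stub `stub_varianceBudget` of crux stmt-SmoothPoincare4-10870), then Chang–Gursky–Yang's Theorem A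
(`hCGY : EntropyRung.ChangGurskyYang`) gives `EntropyRung.CompactShrinkerGap`: by Chern–Gauss–Bonnet (now the
theorem `chernGaussBonnet_four_holds`) at `χ(M ≃ₕ S⁴) = 2` the variance budget is the Weyl budget `∫|W|² < 32π²`,
`R > 0` holds on the closed shrinker and `π₁(M) = 1`, which is CGY's hypothesis
(`compactGapOfChangGurskyYang_of_varianceBudget`). [cite: ChangGurskyYang2003, Thm. A and (1.1)] -/
theorem helper_varianceDoorReduction :
    Summit.SmoothPoincare4.SmoothPoincare4.Theses.EntropyRung.ChangGurskyYang →
    (∀ (M : Type) [TopologicalSpace M] [T2Space M] [SecondCountableTopology M]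
      [ChartedSpace (EuclideanSpace ℝ (Fin 4)) M] [IsManifold (𝓡 4) ∞ M] [CompactSpace M]
      [T3Space M] [MeasurableSpace M] [BorelSpace M],
      M ≃ₕ Metric.sphere (0 : EuclideanSpace ℝ (Fin 5)) 1 →
    ∀ (g : Literature.Geometry.Lorentzian.PseudoRiemannianMetric (𝓡 4) ∞ (EuclideanSpace ℝ (Fin 4))
        (TangentSpace (𝓡 4) : M → Type _)) [g.HasLeviCivita] (f : M → ℝ) (hg : g.IsRiemannian),
      ContMDiff (𝓡 4) 𝓘(ℝ, ℝ) ∞ f →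
      (∀ (x : M) (X Y : TangentSpace (𝓡 4) x),
        g.ricci x X Y + g.hessian f x X Y = (1 / 2 : ℝ) * g.val x X Y) →
      (∀ x : M, g.scalarCurvature x + g.gradSq f x = f x) →
      ENNReal.ofReal (32 * Real.pi ^ 2 * Real.sqrt Real.pi * Real.exp (-(3 : ℝ) / 2)) <
        ∫⁻ x, ENNReal.ofReal (Real.exp (-f x))
          ∂(Literature.Geometry.Lorentzian.riemannianMeasure (g.toContMDiffRiemannianMetric hg)) →
      ∫ x, (g.scalarCurvature x - 2) ^ 2
          ∂(Literature.Geometry.Lorentzian.riemannianMeasure (g.toContMDiffRiemannianMetric hg)) <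
        2 * ((Literature.Geometry.Lorentzian.riemannianMeasure (g.toContMDiffRiemannianMetric hg))
              Set.univ).toReal - 96 * Real.pi ^ 2) →
    Summit.SmoothPoincare4.SmoothPoincare4.Theses.EntropyRung.CompactShrinkerGap := fun hCGY hVB ↦
  compactGapOfChangGurskyYang_of_varianceBudget
    Literature.Geometry.Riemannian.chernGaussBonnet_four_holds hVB hCGY

/-- **Door A″ (sup bound `R ≤ 7/2`), CGB-free.** If every dense normalised gradient shrinker on a closed homotopy
4-sphere has `R ≤ 7/2` everywhere (VERBATIM the registered stub `stub_scalarLeSevenHalves`), then `hCGY` gives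
`EntropyRung.CompactShrinkerGap`: the landed LP-dual level-set certificate (`stub_levelSetCertificate`, p123399)
integrated against the six landed level-set identities (`stub_varianceBudget_of_certificate`, p122222) turns
`R ≤ 7/2` into the variance budget, and `helper_varianceDoorReduction` finishes. [cite: ChengRibeiroZhou2022, §3.2]
[cite: ChangGurskyYang2003, Thm. A] -/
theorem helper_levelSetDoorReduction :
    Summit.SmoothPoincare4.SmoothPoincare4.Theses.EntropyRung.ChangGurskyYang →
    (∀ (M : Type) [TopologicalSpace M] [T2Space M] [SecondCountableTopology M]
      [ChartedSpace (EuclideanSpace ℝ (Fin 4)) M] [IsManifold (𝓡 4) ∞ M] [CompactSpace M]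
      [T3Space M] [MeasurableSpace M] [BorelSpace M],
      M ≃ₕ Metric.sphere (0 : EuclideanSpace ℝ (Fin 5)) 1 →
    ∀ (g : Literature.Geometry.Lorentzian.PseudoRiemannianMetric (𝓡 4) ∞ (EuclideanSpace ℝ (Fin 4))
        (TangentSpace (𝓡 4) : M → Type _)) [g.HasLeviCivita] (f : M → ℝ) (hg : g.IsRiemannian),
      ContMDiff (𝓡 4) 𝓘(ℝ, ℝ) ∞ f →
      (∀ (x : M) (X Y : TangentSpace (𝓡 4) x),
        g.ricci x X Y + g.hessian f x X Y = (1 / 2 : ℝ) * g.val x X Y) →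
      (∀ x : M, g.scalarCurvature x + g.gradSq f x = f x) →
      ENNReal.ofReal (32 * Real.pi ^ 2 * Real.sqrt Real.pi * Real.exp (-(3 : ℝ) / 2)) <
        ∫⁻ x, ENNReal.ofReal (Real.exp (-f x))
          ∂(Literature.Geometry.Lorentzian.riemannianMeasure (g.toContMDiffRiemannianMetric hg)) →
      ∀ x : M, g.scalarCurvature x ≤ 7 / 2) →
    Summit.SmoothPoincare4.SmoothPoincare4.Theses.EntropyRung.CompactShrinkerGap := fun hCGY h7 ↦
  helper_varianceDoorReduction hCGY fun M _ _ _ _ _ _ _ _ _ e g _ f hg hf hsol hnorm hdens ↦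
    stub_varianceBudget_of_certificate stub_levelSetCertificate M g f hg hf hsol hnorm hdens
      (h7 M e g f hg hf hsol hnorm hdens)

/-- **Door A‴ (volume comparison `Vol ≤ 96π²` and crude sup bound `R ≤ 10`), CGB-free.** If every dense
normalised gradient shrinker on a closed homotopy 4-sphere has `Vol(M,g) ≤ 96π² = Vol(S⁴(√6))` (VERBATIM the
registered stub `stub_volumeComparison`) and `R ≤ 10` everywhere (VERBATIM `stub_scalarLeTen`), then `hCGY` gives
`EntropyRung.CompactShrinkerGap`: the landed volume certificate (`stub_volumeCertificate`, p125661) integrated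
against the landed identities plus the volume row (`stub_varianceBudget_of_volumeCertificate`, p124526) yields the
variance budget, and `helper_varianceDoorReduction` finishes. [cite: ChengRibeiroZhou2022, Thm. 2]
[cite: ChangGurskyYang2003, Thm. A] -/
theorem helper_volumeDoorReduction :
    Summit.SmoothPoincare4.SmoothPoincare4.Theses.EntropyRung.ChangGurskyYang →
    (∀ (M : Type) [TopologicalSpace M] [T2Space M] [SecondCountableTopology M]
      [ChartedSpace (EuclideanSpace ℝ (Fin 4)) M] [IsManifold (𝓡 4) ∞ M] [CompactSpace M]
      [T3Space M] [MeasurableSpace M] [BorelSpace M],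
      M ≃ₕ Metric.sphere (0 : EuclideanSpace ℝ (Fin 5)) 1 →
    ∀ (g : Literature.Geometry.Lorentzian.PseudoRiemannianMetric (𝓡 4) ∞ (EuclideanSpace ℝ (Fin 4))
        (TangentSpace (𝓡 4) : M → Type _)) [g.HasLeviCivita] (f : M → ℝ) (hg : g.IsRiemannian),
      ContMDiff (𝓡 4) 𝓘(ℝ, ℝ) ∞ f →
      (∀ (x : M) (X Y : TangentSpace (𝓡 4) x),
        g.ricci x X Y + g.hessian f x X Y = (1 / 2 : ℝ) * g.val x X Y) →
      (∀ x : M, g.scalarCurvature x + g.gradSq f x = f x) →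
      ENNReal.ofReal (32 * Real.pi ^ 2 * Real.sqrt Real.pi * Real.exp (-(3 : ℝ) / 2)) <
        ∫⁻ x, ENNReal.ofReal (Real.exp (-f x))
          ∂(Literature.Geometry.Lorentzian.riemannianMeasure (g.toContMDiffRiemannianMetric hg)) →
      ((Literature.Geometry.Lorentzian.riemannianMeasure (g.toContMDiffRiemannianMetric hg)) Set.univ).toReal ≤
        96 * Real.pi ^ 2) →
    (∀ (M : Type) [TopologicalSpace M] [T2Space M] [SecondCountableTopology M]
      [ChartedSpace (EuclideanSpace ℝ (Fin 4)) M] [IsManifold (𝓡 4) ∞ M] [CompactSpace M]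
      [T3Space M] [MeasurableSpace M] [BorelSpace M],
      M ≃ₕ Metric.sphere (0 : EuclideanSpace ℝ (Fin 5)) 1 →
    ∀ (g : Literature.Geometry.Lorentzian.PseudoRiemannianMetric (𝓡 4) ∞ (EuclideanSpace ℝ (Fin 4))
        (TangentSpace (𝓡 4) : M → Type _)) [g.HasLeviCivita] (f : M → ℝ) (hg : g.IsRiemannian),
      ContMDiff (𝓡 4) 𝓘(ℝ, ℝ) ∞ f →
      (∀ (x : M) (X Y : TangentSpace (𝓡 4) x),
        g.ricci x X Y + g.hessian f x X Y = (1 / 2 : ℝ) * g.val x X Y) →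
      (∀ x : M, g.scalarCurvature x + g.gradSq f x = f x) →
      ENNReal.ofReal (32 * Real.pi ^ 2 * Real.sqrt Real.pi * Real.exp (-(3 : ℝ) / 2)) <
        ∫⁻ x, ENNReal.ofReal (Real.exp (-f x))
          ∂(Literature.Geometry.Lorentzian.riemannianMeasure (g.toContMDiffRiemannianMetric hg)) →
      ∀ x : M, g.scalarCurvature x ≤ 10) →
    Summit.SmoothPoincare4.SmoothPoincare4.Theses.EntropyRung.CompactShrinkerGap := fun hCGY hV h10 ↦
  helper_varianceDoorReduction hCGY fun M _ _ _ _ _ _ _ _ _ e g _ f hg hf hsol hnorm hdens ↦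
    stub_varianceBudget_of_volumeCertificate stub_volumeCertificate M g f hg hf hsol hnorm hdens
      (hV M e g f hg hf hsol hnorm hdens) (h10 M e g f hg hf hsol hnorm hdens)

/-- **Door A‴ reshaped (skeleton v15.1): volume comparison + a sup bound CONDITIONAL ON IT, CGB-free.** If every dense
normalised gradient shrinker on a closed homotopy 4-sphere has `Vol(M,g) ≤ 96π²` (VERBATIM the registered stub
`stub_volumeComparison`) and every such shrinker WITH `Vol(M,g) ≤ 96π²` has `R ≤ 10` everywhere (VERBATIM the registered
stub `stub_scalarLeTen_of_volume`, the tenth lead's reshape of `stub_scalarLeTen`: the volume hypothesis is what lets the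
landed density pinning confine the hot region `{f ≥ 4}` to volume `≤ 41.4`), then `hCGY` gives
`EntropyRung.CompactShrinkerGap` — the second hypothesis is fed the first's conclusion, then `helper_volumeDoorReduction`.
[cite: ChengRibeiroZhou2022, Thm. 2] [cite: ChangGurskyYang2003, Thm. A] -/
theorem helper_volumeDoorReduction' :
    Summit.SmoothPoincare4.SmoothPoincare4.Theses.EntropyRung.ChangGurskyYang →
    (∀ (M : Type) [TopologicalSpace M] [T2Space M] [SecondCountableTopology M]
      [ChartedSpace (EuclideanSpace ℝ (Fin 4)) M] [IsManifold (𝓡 4) ∞ M] [CompactSpace M]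
      [T3Space M] [MeasurableSpace M] [BorelSpace M],
      M ≃ₕ Metric.sphere (0 : EuclideanSpace ℝ (Fin 5)) 1 →
    ∀ (g : Literature.Geometry.Lorentzian.PseudoRiemannianMetric (𝓡 4) ∞ (EuclideanSpace ℝ (Fin 4))
        (TangentSpace (𝓡 4) : M → Type _)) [g.HasLeviCivita] (f : M → ℝ) (hg : g.IsRiemannian),
      ContMDiff (𝓡 4) 𝓘(ℝ, ℝ) ∞ f →
      (∀ (x : M) (X Y : TangentSpace (𝓡 4) x),
        g.ricci x X Y + g.hessian f x X Y = (1 / 2 : ℝ) * g.val x X Y) →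
      (∀ x : M, g.scalarCurvature x + g.gradSq f x = f x) →
      ENNReal.ofReal (32 * Real.pi ^ 2 * Real.sqrt Real.pi * Real.exp (-(3 : ℝ) / 2)) <
        ∫⁻ x, ENNReal.ofReal (Real.exp (-f x))
          ∂(Literature.Geometry.Lorentzian.riemannianMeasure (g.toContMDiffRiemannianMetric hg)) →
      ((Literature.Geometry.Lorentzian.riemannianMeasure (g.toContMDiffRiemannianMetric hg)) Set.univ).toReal ≤
        96 * Real.pi ^ 2) →
    (∀ (M : Type) [TopologicalSpace M] [T2Space M] [SecondCountableTopology M]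
      [ChartedSpace (EuclideanSpace ℝ (Fin 4)) M] [IsManifold (𝓡 4) ∞ M] [CompactSpace M]
      [T3Space M] [MeasurableSpace M] [BorelSpace M],
      M ≃ₕ Metric.sphere (0 : EuclideanSpace ℝ (Fin 5)) 1 →
    ∀ (g : Literature.Geometry.Lorentzian.PseudoRiemannianMetric (𝓡 4) ∞ (EuclideanSpace ℝ (Fin 4))
        (TangentSpace (𝓡 4) : M → Type _)) [g.HasLeviCivita] (f : M → ℝ) (hg : g.IsRiemannian),
      ContMDiff (𝓡 4) 𝓘(ℝ, ℝ) ∞ f →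
      (∀ (x : M) (X Y : TangentSpace (𝓡 4) x),
        g.ricci x X Y + g.hessian f x X Y = (1 / 2 : ℝ) * g.val x X Y) →
      (∀ x : M, g.scalarCurvature x + g.gradSq f x = f x) →
      ENNReal.ofReal (32 * Real.pi ^ 2 * Real.sqrt Real.pi * Real.exp (-(3 : ℝ) / 2)) <
        ∫⁻ x, ENNReal.ofReal (Real.exp (-f x))
          ∂(Literature.Geometry.Lorentzian.riemannianMeasure (g.toContMDiffRiemannianMetric hg)) →
      ((Literature.Geometry.Lorentzian.riemannianMeasure (g.toContMDiffRiemannianMetric hg)) Set.univ).toReal ≤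
        96 * Real.pi ^ 2 →
      ∀ x : M, g.scalarCurvature x ≤ 10) →
    Summit.SmoothPoincare4.SmoothPoincare4.Theses.EntropyRung.CompactShrinkerGap := fun hCGY hV h10 ↦
  helper_volumeDoorReduction hCGY hV fun M _ _ _ _ _ _ _ _ _ e g _ f hg hf hsol hnorm hdens ↦
    h10 M e g f hg hf hsol hnorm hdens (hV M e g f hg hf hsol hnorm hdens)

end Summit.SmoothPoincare4.SmoothPoincare4.Theorems

end
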